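/-
Copyright (c) 2026 the pub-hodgecm-mathlib formalisation cell (harness21).  Prover seat hodgecm-mathlib-K2E4-p10 (g6), Track B ∕ K2-LIT, h413 =
`stmt-HodgeConjecture-24833`, line `K2_E1_TraceFormulaBeta`, rung (ρ2) «cusp forms have mean zero» — ROAD B «SOFT MEAN-ZERO» (dealer K2E1-plan (g6) WAVE 1 (1),
2026-09-04T09:52:04Z: «ROAD B ADOPTED, ROAD A DROPPED; (R-c)₃ STRUCK»).
-/
import Summits.HodgeConjecture.HodgeConjecture.Theorems.K2E1BLEisensteinCuspOrthogonalU       -- ★ P7 FILE A (K2E4-p23 g0): `⟨E(f), Λ⟩_X = c_μ·[f, Λ_B]_β`, `= 0` for `Λ_B ≡ 0`, every rank; brings `eisensteinSeriesU`, the cosets dictionary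
import Summits.HodgeConjecture.HodgeConjecture.Theorems.K2E1BLEisensteinInWeightedSpaceU2      -- ★ P7 FILE B (K2E4-p23 g0): `lintegral_weight_enorm_mul_lt_top_of_lintegral_quotient_lt_top`, `exists_isCoveringWeight_arithmeticBorel`
import Summits.HodgeConjecture.HodgeConjecture.Theorems.K2E1CuspConditionDictionaryU          -- ★ (β1) (K2E4-p23 g0): `invQuot_package_of_mem_cuspForms`
import Summits.HodgeConjecture.HodgeConjecture.Theorems.K2E1ConstantLineResidualU2            -- ★ (ρ2) (K2E4-p14 g6): `rightRegular_const`, `inner_const_one_left`, `span_const_le_residualSubspace`; brings the CM defs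
import Literature.NumberTheory.Automorphic.AutomorphicQuotientErgodic                         -- ★ `ergodicSMul_automorphicQuotient`, `ae_eq_const_of_rightRegular_apply_eq`, `measureReal_univ_ne_zero`
import Literature.NumberTheory.Automorphic.UnitaryGroupBorelHeightContinuous                  -- ★ `continuous_borelHeight`
import Mathlib.Analysis.InnerProductSpace.Projection.Basic
import HarnessLib

/-!
# K2·E1 — `K2E1CuspFormsMeanZeroSoftU`: CUSP FORMS HAVE MEAN ZERO — `∫_X φ dμ = 0` FOR EVERY CUSP FORM OF THE QUASI-SPLIT `U(J_N)_{E∕F}`, BY ERGODICITY (no Eisenstein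
# continuation, no residue, no decay letter); every rank, LETTER-FREE at the CM pair for `N = 2` and `N = 3`

Track B ∕ K2-LIT, crux h413 = `stmt-HodgeConjecture-24833`, route of record `HCCMUnconditional`; cell `hodgecm-mathlib`, squad K2, ENGINE E1.  Prover seat `hodgecm-mathlib-K2E4-p10`
(g6); ROAD B «SOFT MEAN-ZERO» of the dealer K2E1-plan (g6) (WAVE 1 (1), 09:52:04Z; supersedes the struck hypothesis-first twin (R-c)₃ and demotes (R-d2)∕(2b)-𝔛 to fallback).
THEOREMS ONLY (no `def`, no `instance`, no notation, no named-fact hypothesis, no `sorry`); lane `--supports stmt-HodgeConjecture-24833 --as helper` (count-neutral).  Closes no socket.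

THE MATHEMATICS (von Neumann ∕ Zimmer; [MoeglinWaldspurger1995, I.2.18], [BorelJacquet1979, §4.4–§4.6], [Zimmer1984, §2.2]).  Let `X = G(F)∖G(𝔸)` carry an automorphic measure `μ`
(finite, `G(𝔸)`-invariant, positive on opens), `R` the regular representation on `H = L²(X, μ)`, `L²_cusp ≤ H` the cuspidal subspace (the CLOSURE of the classes of the continuous
square-integrable cusp forms, a closed `R`-invariant subspace ★ `cuspidalSubspace`), `P` the orthogonal projection onto `L²_cusp`, `𝟙 ∈ H` the constant.
(1) `v := P𝟙` is `R`-FIXED: `R(g)` is unitary and preserves `L²_cusp` and `L²_cusp^⊥`, so `R(g)P = PR(g)` and `R(g)𝟙 = 𝟙`.  (2) `G(𝔸)` acts ERGODICALLY on `X` (★ Literature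
`AutomorphicQuotientErgodic`), so `v = κ·𝟙` a.e. for a constant `κ`.  (3) A WITNESS: there is `u ∈ H` with `⟪u, 𝟙⟫ ≠ 0` and `⟪u, φ⟫ = 0` for every cusp form `φ` — hence `u ⊥ L²_cusp`
(closure), `0 = ⟪u, v⟫ = κ⟪u, 𝟙⟫`, `κ = 0`, `P𝟙 = 0`, i.e. **`𝟙 ⊥ L²_cusp`: `∫_X f dμ = ⟪𝟙, f⟫ = ⟪𝟙, Pf⟫ = ⟪P𝟙, f⟫ = 0` for every `f ∈ L²_cusp`**, in particular for every cusp form.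
For `G = U(J_N)` the witness is the BOREL EISENSTEIN SERIES OF THE HEIGHT CUT-OFF `𝟙_{H > T}`: `u(x) = E(𝟙_{H>T})(x̃⁻¹) = #{q ∈ B(F)∖G(F) : H(q̃ x̃⁻¹) > T}`, a bounded Borel
function (reduction theory: the count is `≤ M` uniformly ★ BL-R1 `exists_ncard_setOf_lt_borelHeight_le_cm(_three)`, and `≥ 1` everywhere once `T` is below the covering floor ★
`exists_pos_forall_exists_lt_borelHeight_mul_cm(_three)`), so `⟪u, 𝟙⟫ = ∫ u ≥ μ(X) > 0`; and `⟪u, φ⟫ = conj ∫_X E(𝟙_{H>T})·conj φ = conj(c_μ·[𝟙_{H>T}, (φ̃)_B]_β) = 0` because the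
Eisenstein series pairs with an automorphic function only through its constant term (★ P7 FILE A, the unfolding along `B(F)N(𝔸)∖G(𝔸)`) and `(φ̃)_B ≡ 0` for a cusp form (★ (β1)).
NO analytic continuation of Eisenstein series, no residue, no Maass–Selberg, no decay letter: the identity `⟪𝟙, L²_cusp⟫ = 0` («the constants are residual») is soft.
* §1 ANY adelic group datum `𝒢` (`G(𝔸)` locally compact, second countable), automorphic `μ`, any family of radicals `𝔓`: `cuspidalSubspace_le_orthogonal_span_of_forall_inner_eq_zero`,
  `rightRegular_starProjection_const`, `starProjection_cuspidalSubspace_const_eq_zero_of_witness`, **`integral_eq_zero_of_mem_cuspidalSubspace_of_witness`**,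
  `integral_eq_zero_of_mem_cuspForms_of_witness` — steps (1)–(3) given a witness `u`.
* §2 `G = U(J_N)_{E∕F}` (Mok's `quasiSplit F E c N`, every `N`): the witness `u = quotFun (E 𝟙_{H>T})` — the count formula, `1 ≤ u ≤ M`, `u ∈ L²`, `⟪u, 𝟙⟫ ≠ 0`, `⟪u, φ⟫ = 0`.
* §3 HEAD, every rank, hypothesis-first on the reduction-theory data (`T`, finiteness, the bound `M`, the floor) and FILE A's measure letters (`ν_G`, `ν_N`, `hconj`, `𝓕`):
  **`integral_eq_zero_of_mem_cuspForms`** — `∫_X φ dμ = 0` for every `φ ∈ cuspForms μ 𝔓` (`𝔓.radical i = N(𝔸)`), and the `L²_cusp` form.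
* THE CM PAIR `(L⁺, L)`, `N = 2` AND `N = 3`, LETTER-FREE, and the route's literal datum `cmDatum L N Φ_N` (`hmean_cm_two`, `hmean_cm_threeR`, the letter-free rungs
  `span_const_le_cmResidualSubspace_two ∕ …R_three`): the sibling file `K2E1CuspFormsMeanZeroSoftUCM` (400-line law).
HONEST LABEL: HC_CM is proved only modulo the 7 printed citations (2 remaining named inputs: hLiu418 = `stmt-HodgeConjecture-24832`, h413 = `stmt-HodgeConjecture-24833`) until rung 0
closes; this file asserts no named fact and closes no socket.
References: [MoeglinWaldspurger1995] C. Mœglin, J.-L. Waldspurger, *Spectral Decomposition and Eisenstein Series* (1995), I.2.18, II.1.7–II.1.8 · [BorelJacquet1979] A. Borel, H. Jacquet,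
*Automorphic forms and automorphic representations*, PSPM 33.1 (1979), §4.4–§4.6 · [Zimmer1984] R. J. Zimmer, *Ergodic theory and semisimple groups* (1984), §2.2 · [BernsteinLapid2019]
J. Bernstein, E. Lapid, arXiv:1911.02342, §4 Claim 2 · [GodementJacquet1972] R. Godement, H. Jacquet, *Zeta functions of simple algebras*, LNM 260 (1972), §12 · [Garrett2018] §2.3, §2.10.
-/

set_option autoImplicit false
-- the mandated namespace repeats the single-problem summit's segment (`HodgeConjecture.HodgeConjecture`)
set_option linter.dupNamespace false

noncomputable section

open MeasureTheory Measure NumberField IsDedekindDomain Set MulAction ContRepresentation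
open scoped ENNReal NNReal ComplexConjugate InnerProductSpace
open Literature.MeasureTheory.Group Literature.NumberTheory
open Literature.NumberTheory.Automorphic Literature.NumberTheory.Automorphic.UnitaryGroup AdelicGroupData
open Summit.HodgeConjecture.HodgeConjecture.Cruxes.H413.K2E1BorelEisensteinU
open Summit.HodgeConjecture.HodgeConjecture.Cruxes.H413.K2E1BorelCosetsDictionary (eisensteinSeriesU_eq_tsum_arithmeticBorelQuot)
open Summit.HodgeConjecture.HodgeConjecture.Cruxes.H413.K2E1BLEisensteinCuspOrthogonalU (integrable_and_integral_quotFun_eisensteinSeriesU_mul_conj_eq integral_quotFun_eisensteinSeriesU_mul_conj_eq_zero_of_borelConstantTerm_eq_zero)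
open Summit.HodgeConjecture.HodgeConjecture.Cruxes.H413.K2E1BLEisensteinInWeightedSpaceU2 (lintegral_weight_enorm_mul_lt_top_of_lintegral_quotient_lt_top exists_isCoveringWeight_arithmeticBorel)
open Summit.HodgeConjecture.HodgeConjecture.Cruxes.H413.K2E1CuspConditionDictionaryU (invQuot_package_of_mem_cuspForms)
open Summit.HodgeConjecture.HodgeConjecture.Cruxes.H413.K2E1ConstantLineResidualU2 (rightRegular_const inner_const_one_left span_const_le_residualSubspace)
open Summit.HodgeConjecture.HodgeConjecture.Cruxes.H413.K2E1CuspidalSpectrumUnitary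

namespace Summit.HodgeConjecture.HodgeConjecture.Cruxes.H413.K2E1CuspFormsMeanZeroSoftU

universe u

/-! ## §1 The soft argument for ANY adelic group datum: a witness `u` with `⟪u, 𝟙⟫ ≠ 0`, `u ⊥` cusp forms ⟹ `𝟙 ⊥ L²_cusp` -/

section Soft

variable {K : Type} [Field K] [NumberField K] (𝒢 : AdelicGroupData.{u} K) [LocallyCompactSpace 𝒢.Adelic] [SecondCountableTopology 𝒢.Adelic]
  (μ : Measure 𝒢.automorphicQuotient) [𝒢.IsAutomorphicMeasure μ] (𝔓 : 𝒢.ParabolicUnipotentData)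

omit [LocallyCompactSpace 𝒢.Adelic] [SecondCountableTopology 𝒢.Adelic] in
/-- **`L²_cusp ≤ (ℂ ∙ u)ᗮ` for every `u` orthogonal to the cusp forms**: the cuspidal subspace is the `L²`-CLOSURE of the classes of the continuous square-integrable cusp forms (★
`toSubmodule_cuspidalSubspace`) and `(ℂ ∙ u)ᗮ` is closed (Mathlib `Submodule.topologicalClosure_minimal`; the pattern of ★ `cuspidalSubspace_le_orthogonal_span_const`).
[cite: BorelJacquet1979, §4.6] [cite: MoeglinWaldspurger1995, I.2.18] -/
theorem cuspidalSubspace_le_orthogonal_span_of_forall_inner_eq_zero (u : 𝒢.L2 μ) (horth : ∀ φ : ↥(𝒢.cuspForms μ 𝔓), ⟪u, 𝒢.cuspFormsToLp μ 𝔓 φ⟫_ℂ = 0) :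
    (𝒢.cuspidalSubspace μ 𝔓).toSubmodule ≤ (ℂ ∙ u)ᗮ := by
  rw [AdelicGroupData.toSubmodule_cuspidalSubspace]
  refine Submodule.topologicalClosure_minimal _ (fun w hw => ?_) (Submodule.isClosed_orthogonal _)
  obtain ⟨φ, rfl⟩ := hw
  rw [Submodule.mem_orthogonal_singleton_iff_inner_right]
  exact horth φ

omit [LocallyCompactSpace 𝒢.Adelic] [SecondCountableTopology 𝒢.Adelic] in
/-- `R(g) (R(g⁻¹) f) = f` (the regular representation is a homomorphism). [folklore] -/
theorem rightRegular_apply_rightRegular_inv (g : 𝒢.Adelic) (f : 𝒢.L2 μ) : 𝒢.rightRegular μ g (𝒢.rightRegular μ g⁻¹ f) = f := by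
  have h := congrArg (fun T : 𝒢.L2 μ →L[ℂ] 𝒢.L2 μ => T f) (map_mul (𝒢.rightRegular μ) g g⁻¹)
  simp only [mul_inv_cancel, map_one] at h
  exact h.symm

omit [LocallyCompactSpace 𝒢.Adelic] [SecondCountableTopology 𝒢.Adelic] in
/-- **STEP (1): THE PROJECTION OF `𝟙` ONTO A CLOSED INVARIANT SUBSPACE IS `R`-FIXED.**  For a closed subrepresentation `W` of the regular representation and every `g`,
`R(g)(P_W 𝟙) = P_W 𝟙`: `R(g)P_W𝟙 ∈ W` (invariance), and `𝟙 − R(g)P_W𝟙 = R(g)(𝟙 − P_W𝟙)` (★ `rightRegular_const`) is orthogonal to `W = R(g)R(g⁻¹)W` because `R(g)` preserves inner products (★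
`norm_rightRegular_apply`, Mathlib `LinearIsometry.inner_map_map`); uniqueness of the orthogonal projection (Mathlib `Submodule.eq_starProjection_of_mem_of_inner_eq_zero`).  The generic
twin of ★ `GLnCuspFormsOrthogonalConstants.rightRegular_starProjection_oneL2`. [cite: BorelJacquet1979, §4.6] [cite: Zimmer1984, §2.2] -/
theorem rightRegular_starProjection_const (W : ClosedSubrep (𝒢.rightRegular μ)) (g : 𝒢.Adelic) :
    𝒢.rightRegular μ g (W.toSubmodule.starProjection (Lp.const 2 μ (1 : ℂ))) = W.toSubmodule.starProjection (Lp.const 2 μ (1 : ℂ)) := by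
  -- `R(g)` as a linear isometry
  let T : 𝒢.L2 μ →ₗᵢ[ℂ] 𝒢.L2 μ := { (𝒢.rightRegular μ g).toLinearMap with norm_map' := 𝒢.norm_rightRegular_apply μ g }
  have hT : ∀ f, T f = 𝒢.rightRegular μ g f := fun _ => rfl
  symm
  refine Submodule.eq_starProjection_of_mem_of_inner_eq_zero ?_ fun w hw => ?_
  · exact W.apply_mem_toSubmodule g (W.toSubmodule.starProjection_apply_mem _)
  · have hw' : 𝒢.rightRegular μ g⁻¹ w ∈ W.toSubmodule := W.apply_mem_toSubmodule g⁻¹ hw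
    have h0 := Submodule.starProjection_inner_eq_zero (K := W.toSubmodule) (Lp.const 2 μ (1 : ℂ)) _ hw'
    have e1 : (Lp.const 2 μ (1 : ℂ) : 𝒢.L2 μ) - 𝒢.rightRegular μ g (W.toSubmodule.starProjection (Lp.const 2 μ (1 : ℂ))) =
        𝒢.rightRegular μ g ((Lp.const 2 μ (1 : ℂ) : 𝒢.L2 μ) - W.toSubmodule.starProjection (Lp.const 2 μ (1 : ℂ))) := by
      rw [map_sub, rightRegular_const]
    rw [e1, ← rightRegular_apply_rightRegular_inv 𝒢 μ g w, ← hT, ← hT, LinearIsometry.inner_map_map]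
    exact h0

/-- **STEPS (2)–(3): THE PROJECTION OF `𝟙` ONTO `L²_cusp` VANISHES, GIVEN A WITNESS.**  If some `u ∈ L²(X, μ)` has `⟪u, 𝟙⟫ ≠ 0` and is orthogonal to (the class of) every continuous
square-integrable cusp form, then `P_{L²_cusp} 𝟙 = 0`: `v := P𝟙` is `R`-fixed (§1 step (1)), hence a.e. a constant `κ` (ERGODICITY of `G(𝔸)` on `X`, ★ `ae_eq_const_of_rightRegular_apply_eq`), so
`v = κ·𝟙`; `v ∈ L²_cusp ≤ (ℂ ∙ u)ᗮ` gives `0 = ⟪u, κ·𝟙⟫ = κ·⟪u, 𝟙⟫`, whence `κ = 0`. [cite: Zimmer1984, §2.2] [cite: MoeglinWaldspurger1995, I.2.18] -/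
theorem starProjection_cuspidalSubspace_const_eq_zero_of_witness {u : 𝒢.L2 μ} (hu : ⟪u, (Lp.const 2 μ (1 : ℂ) : 𝒢.L2 μ)⟫_ℂ ≠ 0)
    (horth : ∀ φ : ↥(𝒢.cuspForms μ 𝔓), ⟪u, 𝒢.cuspFormsToLp μ 𝔓 φ⟫_ℂ = 0) :
    (𝒢.cuspidalSubspace μ 𝔓).toSubmodule.starProjection (Lp.const 2 μ (1 : ℂ)) = 0 := by
  set v := (𝒢.cuspidalSubspace μ 𝔓).toSubmodule.starProjection (Lp.const 2 μ (1 : ℂ)) with hv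
  obtain ⟨κ, hκ⟩ := 𝒢.ae_eq_const_of_rightRegular_apply_eq μ (f := v) (rightRegular_starProjection_const 𝒢 μ (𝒢.cuspidalSubspace μ 𝔓))
  -- `v = κ • 𝟙` in `L²`
  have hv1 : v = κ • (Lp.const 2 μ (1 : ℂ) : 𝒢.L2 μ) := by
    refine Lp.ext (hκ.trans ?_)
    filter_upwards [Lp.coeFn_smul κ (Lp.const 2 μ (1 : ℂ) : 𝒢.L2 μ), Lp.coeFn_const 2 μ (1 : ℂ)] with x hx hx1
    rw [hx, Pi.smul_apply, hx1, Function.const_apply, Function.const_apply, smul_eq_mul, mul_one]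
  -- `v ∈ L²_cusp ≤ (ℂ ∙ u)ᗮ`, so `κ ⟪u, 𝟙⟫ = 0`
  have hmem : v ∈ (ℂ ∙ u)ᗮ :=
    cuspidalSubspace_le_orthogonal_span_of_forall_inner_eq_zero 𝒢 μ 𝔓 u horth ((𝒢.cuspidalSubspace μ 𝔓).toSubmodule.starProjection_apply_mem _)
  rw [Submodule.mem_orthogonal_singleton_iff_inner_right, hv1, inner_smul_right, mul_eq_zero] at hmem
  rw [hv1, hmem.resolve_right hu, zero_smul]

/-- **`∫_X f dμ = 0` FOR EVERY `f ∈ L²_cusp`, GIVEN A WITNESS** (`⟪𝟙, f⟫ = ⟪𝟙, Pf⟫ = ⟪P𝟙, f⟫ = 0`, ★ `inner_const_one_left`).  The generic twin of ★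
`GLnCuspFormsOrthogonalConstants.integral_eq_zero_of_mem_cuspidalSubspace` with the `GL_n` smoothing step replaced by a witness. [cite: MoeglinWaldspurger1995, I.2.18] [cite: BorelJacquet1979, §4.6] -/
theorem integral_eq_zero_of_mem_cuspidalSubspace_of_witness {u : 𝒢.L2 μ} (hu : ⟪u, (Lp.const 2 μ (1 : ℂ) : 𝒢.L2 μ)⟫_ℂ ≠ 0)
    (horth : ∀ φ : ↥(𝒢.cuspForms μ 𝔓), ⟪u, 𝒢.cuspFormsToLp μ 𝔓 φ⟫_ℂ = 0) {f : 𝒢.L2 μ} (hf : f ∈ 𝒢.cuspidalSubspace μ 𝔓) :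
    ∫ x, (f : 𝒢.automorphicQuotient → ℂ) x ∂μ = 0 := by
  rw [← inner_const_one_left 𝒢 μ f]
  have hf' : (𝒢.cuspidalSubspace μ 𝔓).toSubmodule.starProjection f = f := Submodule.starProjection_eq_self_iff.2 hf
  rw [← hf', ← Submodule.inner_starProjection_left_eq_right, starProjection_cuspidalSubspace_const_eq_zero_of_witness 𝒢 μ 𝔓 hu horth, inner_zero_left]

/-- **`∫_X φ dμ = 0` FOR EVERY CONTINUOUS SQUARE-INTEGRABLE CUSP FORM, GIVEN A WITNESS** (its class lies in `L²_cusp`, ★ `toLp_mem_cuspidalSubspace`). [cite: MoeglinWaldspurger1995, I.2.18] -/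
theorem integral_eq_zero_of_mem_cuspForms_of_witness {u : 𝒢.L2 μ} (hu : ⟪u, (Lp.const 2 μ (1 : ℂ) : 𝒢.L2 μ)⟫_ℂ ≠ 0)
    (horth : ∀ φ : ↥(𝒢.cuspForms μ 𝔓), ⟪u, 𝒢.cuspFormsToLp μ 𝔓 φ⟫_ℂ = 0) {φ : 𝒢.automorphicQuotient → ℂ} (hφ : φ ∈ 𝒢.cuspForms μ 𝔓) :
    ∫ x, φ x ∂μ = 0 := by
  rw [← integral_congr_ae (MemLp.coeFn_toLp (AdelicGroupData.memLp_of_mem_cuspForms hφ))]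
  exact integral_eq_zero_of_mem_cuspidalSubspace_of_witness 𝒢 μ 𝔓 hu horth (AdelicGroupData.toLp_mem_cuspidalSubspace hφ)

end Soft

/-! ## §2 The witness for `U(J_N)_{E∕F}`: the Borel Eisenstein series of the height cut-off, `u = E(𝟙_{H>T})(x̃⁻¹) = #{q : H(q̃ x̃⁻¹) > T}` -/

section Witness

variable {F E : Type} [Field F] [NumberField F] [Field E] [NumberField E] [Algebra F E] {c : E ≃ₐ[F] E} {N : ℕ} [NeZero N]

/-- `H(⟦γ⟧.out · y) = H(γ · y)`: the chosen representative of the right coset `B(F)γ` differs from `γ` by an element of `B(F)`, under which `H` is invariant (★ `borelHeight_arithmeticBorel_mul`);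
every rank (the rank-specific ★ `borelHeight_out_mk_mul(_two)` verbatim). [cite: Garrett2018, §2.10] -/
theorem borelHeight_rightRelOut_mul (γ : (quasiSplit F E c N).arithmeticSubgroup) (y : (quasiSplit F E c N).Adelic) :
    borelHeight ((((Quotient.mk (QuotientGroup.rightRel (arithmeticBorel F E c N)) γ).out : (quasiSplit F E c N).arithmeticSubgroup) : (quasiSplit F E c N).Adelic) * y) =
      borelHeight ((γ : (quasiSplit F E c N).Adelic) * y) := by
  set o := (Quotient.mk (QuotientGroup.rightRel (arithmeticBorel F E c N)) γ).out with ho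
  have h : γ * o⁻¹ ∈ arithmeticBorel F E c N := by
    have h1 : Quotient.mk (QuotientGroup.rightRel (arithmeticBorel F E c N)) o = Quotient.mk (QuotientGroup.rightRel (arithmeticBorel F E c N)) γ := Quotient.out_eq _
    exact QuotientGroup.rightRel_apply.1 (Quotient.eq.1 h1)
  have e : ((γ : (quasiSplit F E c N).Adelic) * y) = ((γ * o⁻¹ : (quasiSplit F E c N).arithmeticSubgroup) : (quasiSplit F E c N).Adelic) * (((o : (quasiSplit F E c N).arithmeticSubgroup) : (quasiSplit F E c N).Adelic) * y) := by
    rw [Subgroup.coe_mul, Subgroup.coe_inv, mul_assoc, inv_mul_cancel_left]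
  rw [e, K2E1TruncatedEisensteinExplicit.borelHeight_arithmeticBorel_mul h]

/-- **THE COUNT FORMULA**: for the height cut-off `𝟙_{H > T}` and `y ∈ G(𝔸)` with finitely many cosets above height `T`, `Σ'_{q ∈ B(F)∖G(F)} 𝟙_{H>T}(q̃ y) = #{q : H(q̃ y) > T}`
(Track A's index). [cite: Garrett2018, §2.3] [cite: MoeglinWaldspurger1995, II.1.5] -/
theorem tsum_indicator_heightCut_eq_card {T : ℝ≥0} (y : (quasiSplit F E c N).Adelic)
    (hfin : {q : Quotient (QuotientGroup.rightRel (arithmeticBorel F E c N)) |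
      T < borelHeight (((q.out : (quasiSplit F E c N).arithmeticSubgroup) : (quasiSplit F E c N).Adelic) * y)}.Finite) :
    ∑' q : Quotient (QuotientGroup.rightRel (arithmeticBorel F E c N)),
        ({z : (quasiSplit F E c N).Adelic | T < borelHeight z}).indicator (1 : (quasiSplit F E c N).Adelic → ℂ)
          (((q.out : (quasiSplit F E c N).arithmeticSubgroup) : (quasiSplit F E c N).Adelic) * y) = (hfin.toFinset.card : ℂ) := by
  classical
  have h0 : ∀ q ∉ hfin.toFinset, ({z : (quasiSplit F E c N).Adelic | T < borelHeight z}).indicator (1 : (quasiSplit F E c N).Adelic → ℂ)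
      (((q.out : (quasiSplit F E c N).arithmeticSubgroup) : (quasiSplit F E c N).Adelic) * y) = 0 := fun q hq =>
    Set.indicator_of_notMem (show (((q.out : (quasiSplit F E c N).arithmeticSubgroup) : (quasiSplit F E c N).Adelic) * y) ∉
      {z : (quasiSplit F E c N).Adelic | T < borelHeight z} from fun hq' => hq ((Set.Finite.mem_toFinset hfin).2 hq')) _
  have h1 : ∀ q ∈ hfin.toFinset, ({z : (quasiSplit F E c N).Adelic | T < borelHeight z}).indicator (1 : (quasiSplit F E c N).Adelic → ℂ)
      (((q.out : (quasiSplit F E c N).arithmeticSubgroup) : (quasiSplit F E c N).Adelic) * y) = 1 := fun q hq => by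
    rw [Set.indicator_of_mem (show (((q.out : (quasiSplit F E c N).arithmeticSubgroup) : (quasiSplit F E c N).Adelic) * y) ∈
      {z : (quasiSplit F E c N).Adelic | T < borelHeight z} from (Set.Finite.mem_toFinset hfin).1 hq), Pi.one_apply]
  rw [tsum_eq_sum h0, Finset.sum_congr rfl h1, Finset.sum_const, nsmul_eq_mul, mul_one]

/-- The same count bounds the `tsum` of the extended norms: `Σ'_q ‖𝟙_{H>T}(q̃ y)‖ₑ ≤ M` whenever `#{q : H(q̃ y) > T} ≤ M`. [cite: Garrett2018, §2.3] -/
theorem tsum_enorm_indicator_heightCut_le {T : ℝ≥0} (y : (quasiSplit F E c N).Adelic)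
    (hfin : {q : Quotient (QuotientGroup.rightRel (arithmeticBorel F E c N)) |
      T < borelHeight (((q.out : (quasiSplit F E c N).arithmeticSubgroup) : (quasiSplit F E c N).Adelic) * y)}.Finite) {M : ℕ}
    (hM : {q : Quotient (QuotientGroup.rightRel (arithmeticBorel F E c N)) |
      T < borelHeight (((q.out : (quasiSplit F E c N).arithmeticSubgroup) : (quasiSplit F E c N).Adelic) * y)}.ncard ≤ M) :
    ∑' q : Quotient (QuotientGroup.rightRel (arithmeticBorel F E c N)),
        ‖({z : (quasiSplit F E c N).Adelic | T < borelHeight z}).indicator (1 : (quasiSplit F E c N).Adelic → ℂ)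
          (((q.out : (quasiSplit F E c N).arithmeticSubgroup) : (quasiSplit F E c N).Adelic) * y)‖ₑ ≤ M := by
  classical
  have h0 : ∀ q ∉ hfin.toFinset, ‖({z : (quasiSplit F E c N).Adelic | T < borelHeight z}).indicator (1 : (quasiSplit F E c N).Adelic → ℂ)
      (((q.out : (quasiSplit F E c N).arithmeticSubgroup) : (quasiSplit F E c N).Adelic) * y)‖ₑ = 0 := fun q hq => by
    rw [Set.indicator_of_notMem (show (((q.out : (quasiSplit F E c N).arithmeticSubgroup) : (quasiSplit F E c N).Adelic) * y) ∉
      {z : (quasiSplit F E c N).Adelic | T < borelHeight z} from fun hq' => hq ((Set.Finite.mem_toFinset hfin).2 hq')) _, enorm_zero]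
  have h1 : ∀ q ∈ hfin.toFinset, ‖({z : (quasiSplit F E c N).Adelic | T < borelHeight z}).indicator (1 : (quasiSplit F E c N).Adelic → ℂ)
      (((q.out : (quasiSplit F E c N).arithmeticSubgroup) : (quasiSplit F E c N).Adelic) * y)‖ₑ = 1 := fun q hq => by
    rw [Set.indicator_of_mem (show (((q.out : (quasiSplit F E c N).arithmeticSubgroup) : (quasiSplit F E c N).Adelic) * y) ∈
      {z : (quasiSplit F E c N).Adelic | T < borelHeight z} from (Set.Finite.mem_toFinset hfin).1 hq) _, Pi.one_apply, enorm_one]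
  rw [tsum_eq_sum h0, Finset.sum_congr rfl h1, Finset.sum_const, nsmul_eq_mul, mul_one, ← Set.ncard_eq_toFinset_card _ hfin]
  exact_mod_cast hM

/-- **AT LEAST ONE COSET ABOVE THE FLOOR**: if `T < H(γ y)` for some `γ ∈ G(F)`, then `1 ≤ #{q : H(q̃ y) > T}` (the coset of `γ` qualifies, `borelHeight_rightRelOut_mul`). [cite: Borel1963, §5] -/
theorem one_le_card_heightCut {T : ℝ≥0} (y : (quasiSplit F E c N).Adelic)
    (hfin : {q : Quotient (QuotientGroup.rightRel (arithmeticBorel F E c N)) |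
      T < borelHeight (((q.out : (quasiSplit F E c N).arithmeticSubgroup) : (quasiSplit F E c N).Adelic) * y)}.Finite)
    (hcov : ∃ γ : (quasiSplit F E c N).arithmeticSubgroup, T < borelHeight ((γ : (quasiSplit F E c N).Adelic) * y)) : 1 ≤ hfin.toFinset.card := by
  obtain ⟨γ, hγ⟩ := hcov
  refine Finset.one_le_card.2 ⟨Quotient.mk (QuotientGroup.rightRel (arithmeticBorel F E c N)) γ, (Set.Finite.mem_toFinset hfin).2 ?_⟩
  show T < borelHeight _
  rwa [borelHeight_rightRelOut_mul]

variable [MeasurableSpace (quasiSplit F E c N).Adelic] [BorelSpace (quasiSplit F E c N).Adelic]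

/-- **THE WITNESS EXISTS** (every rank, hypothesis-first on the reduction-theory data and FILE A's measure letters): for an automorphic `μ`, an inversion-invariant Haar `ν_G` on `G(𝔸)`,
an inversion-invariant Haar `ν_N` on `N(𝔸)` conjugation-invariant under `B(F)` (`hconj`, ★ at `N = 2, 3`) with a fundamental domain `𝓕` of `N(F)` of finite positive mass, parabolic data
`𝔓` with `𝔓.radical i = N(𝔸)`, and a height `T` for which the coset sets `{q : H(q̃ y) > T}` are finite, of size `≤ M`, and non-empty for every `y` (`hcov`), the class `u` of
`x ↦ E(𝟙_{H>T})(x̃⁻¹)` lies in `L²(X, μ)`, has `⟪u, 𝟙⟫ ≠ 0` (`u ≥ 1`: `Re ∫ u ≥ μ(X) > 0`) and `⟪u, φ⟫ = 0` for every continuous square-integrable cusp form `φ` (★ FILE A: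
`∫_X E(𝟙_{H>T})·conj φ = c_μ·[𝟙_{H>T}, (φ̃)_B]_β = 0`, `(φ̃)_B ≡ 0` by ★ (β1); `u` is a.e. strongly measurable by ★ FILE A at `Λ = 1`, bounded by `M`).
[cite: MoeglinWaldspurger1995, II.1.7–II.1.8] [cite: BorelJacquet1979, §4.4–§4.6] [cite: Garrett2018, §2.3 and §2.10] -/
theorem exists_witness (μ : Measure (quasiSplit F E c N).automorphicQuotient) [(quasiSplit F E c N).IsAutomorphicMeasure μ]
    (νG : Measure (quasiSplit F E c N).Adelic) [νG.IsHaarMeasure] [νG.IsInvInvariant]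
    (νN : Measure ↥(adelicUnipotent F E c N)) [νN.IsHaarMeasure] [νN.IsInvInvariant]
    (hconj : ∀ b₀ (hb₀ : b₀ ∈ borelU (c : E →+* E) ((StdForm.antidiagonal N).over E)),
      νN.map (fun v : ↥(adelicUnipotent F E c N) => (⟨((quasiSplit F E c N).toAdelic b₀)⁻¹ * (v : (quasiSplit F E c N).Adelic) * (quasiSplit F E c N).toAdelic b₀,
        conj_mem_adelicUnipotent ((K2E1PseudoEisensteinConstantTermU.toAdelic_mem_borelAdelic_iff b₀).2 hb₀) v.2⟩ : ↥(adelicUnipotent F E c N))) = νN)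
    {𝓕 : Set ↥(adelicUnipotent F E c N)} (h𝓕 : IsFundamentalDomain ↥(rationalUnipotent F E c N) 𝓕 νN) (h𝓕₀ : νN 𝓕 ≠ 0) (h𝓕top : νN 𝓕 ≠ ∞)
    (𝔓 : (quasiSplit F E c N).ParabolicUnipotentData) (i : 𝔓.ι) (h𝔓 : 𝔓.radical i = adelicUnipotent F E c N) {T : ℝ≥0}
    (hfin : ∀ y : (quasiSplit F E c N).Adelic, {q : Quotient (QuotientGroup.rightRel (arithmeticBorel F E c N)) |
      T < borelHeight (((q.out : (quasiSplit F E c N).arithmeticSubgroup) : (quasiSplit F E c N).Adelic) * y)}.Finite) {M : ℕ}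
    (hM : ∀ y : (quasiSplit F E c N).Adelic, {q : Quotient (QuotientGroup.rightRel (arithmeticBorel F E c N)) |
      T < borelHeight (((q.out : (quasiSplit F E c N).arithmeticSubgroup) : (quasiSplit F E c N).Adelic) * y)}.ncard ≤ M)
    (hcov : ∀ y : (quasiSplit F E c N).Adelic, ∃ γ : (quasiSplit F E c N).arithmeticSubgroup, T < borelHeight ((γ : (quasiSplit F E c N).Adelic) * y)) :
    ∃ u : (quasiSplit F E c N).L2 μ, ⟪u, (Lp.const 2 μ (1 : ℂ) : (quasiSplit F E c N).L2 μ)⟫_ℂ ≠ 0 ∧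
      ∀ φ : ↥((quasiSplit F E c N).cuspForms μ 𝔓), ⟪u, (quasiSplit F E c N).cuspFormsToLp μ 𝔓 φ⟫_ℂ = 0 := by
  classical
  -- the cut-off `f_T = 𝟙_{H > T}`: Borel, left-`N(𝔸)`- and left-`B(F)`-invariant
  set fT : (quasiSplit F E c N).Adelic → ℂ := ({z : (quasiSplit F E c N).Adelic | T < borelHeight z}).indicator (1 : (quasiSplit F E c N).Adelic → ℂ) with hfT
  have hsm : MeasurableSet {z : (quasiSplit F E c N).Adelic | T < borelHeight z} := (isOpen_lt continuous_const continuous_borelHeight).measurableSet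
  have hfm : Measurable fT := measurable_one.indicator hsm
  have hfN : ∀ (v : ↥(adelicUnipotent F E c N)) (g : (quasiSplit F E c N).Adelic), fT ((v : (quasiSplit F E c N).Adelic) * g) = fT g := fun v g => by
    simp only [hfT, Set.indicator_apply, Set.mem_setOf_eq, Pi.one_apply, borelHeight_unipotent_mul v.2]
  have hfB : ∀ b ∈ arithmeticBorel F E c N, ∀ x : (quasiSplit F E c N).Adelic, fT ((b : (quasiSplit F E c N).Adelic) * x) = fT x := fun b hb x => by
    simp only [hfT, Set.indicator_apply, Set.mem_setOf_eq, Pi.one_apply, K2E1TruncatedEisensteinExplicit.borelHeight_arithmeticBorel_mul hb]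
  have h1G : ∀ (γ : (quasiSplit F E c N).arithmeticSubgroup) (x : (quasiSplit F E c N).Adelic), (fun _ : (quasiSplit F E c N).Adelic => (1 : ℂ)) ((γ : (quasiSplit F E c N).Adelic) * x) =
      (fun _ : (quasiSplit F E c N).Adelic => (1 : ℂ)) x := fun _ _ => rfl
  -- the Eisenstein series of `f_T` is the coset count: `1 ≤ E(f_T) ≤ M`
  have hE : ∀ y : (quasiSplit F E c N).Adelic, eisensteinSeriesU fT y = ((hfin y).toFinset.card : ℂ) := fun y => by
    rw [eisensteinSeriesU_eq_tsum_arithmeticBorelQuot hfB y]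
    exact tsum_indicator_heightCut_eq_card y (hfin y)
  have hEle : ∀ y : (quasiSplit F E c N).Adelic, ‖eisensteinSeriesU fT y‖ ≤ M := fun y => by
    rw [hE y, Complex.norm_natCast, ← Set.ncard_eq_toFinset_card _ (hfin y)]
    exact_mod_cast hM y
  have hEge : ∀ y : (quasiSplit F E c N).Adelic, (1 : ℝ) ≤ (eisensteinSeriesU fT y).re := fun y => by
    rw [hE y, Complex.natCast_re]
    exact_mod_cast one_le_card_heightCut y (hfin y) (hcov y)
  have hXpt : ∀ x : (quasiSplit F E c N).automorphicQuotient, (∑' q : Quotient (QuotientGroup.rightRel (arithmeticBorel F E c N)),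
      ‖fT (((q.out : (quasiSplit F E c N).arithmeticSubgroup) : (quasiSplit F E c N).Adelic) * (Quotient.out x : (quasiSplit F E c N).Adelic)⁻¹)‖ₑ) ≤ M := fun x =>
    tsum_enorm_indicator_heightCut_le _ (hfin _) (hM _)
  -- a covering weight of `B(F)♯`
  obtain ⟨β, hβ⟩ := exists_isCoveringWeight_arithmeticBorel (F := F) (E := E) (c := c) (N := N)
  -- `u = quotFun (E f_T)` is integrable (★ FILE A at `Λ = 1`) and bounded by `M`, hence in `L²`
  have hL1one : ∫⁻ g, β g * ‖fT g * conj ((fun _ : (quasiSplit F E c N).Adelic => (1 : ℂ)) g)‖ₑ ∂νG < ∞ := by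
    refine lintegral_weight_enorm_mul_lt_top_of_lintegral_quotient_lt_top μ νG hβ hfm measurable_const hfB h1G ?_
    calc ∫⁻ x : (quasiSplit F E c N).automorphicQuotient, (∑' q : Quotient (QuotientGroup.rightRel (arithmeticBorel F E c N)),
          ‖fT (((q.out : (quasiSplit F E c N).arithmeticSubgroup) : (quasiSplit F E c N).Adelic) * (Quotient.out x : (quasiSplit F E c N).Adelic)⁻¹)‖ₑ) *
            ‖(fun _ : (quasiSplit F E c N).Adelic => (1 : ℂ)) (Quotient.out x : (quasiSplit F E c N).Adelic)⁻¹‖ₑ ∂μ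
        ≤ ∫⁻ _ : (quasiSplit F E c N).automorphicQuotient, (M : ℝ≥0∞) ∂μ := lintegral_mono fun x => by
          rw [enorm_one, mul_one]
          exact hXpt x
      _ < ∞ := by
          rw [lintegral_const]
          exact ENNReal.mul_lt_top (by simp) (measure_lt_top μ _)
  obtain ⟨-, -, hint, -⟩ := integrable_and_integral_quotFun_eisensteinSeriesU_mul_conj_eq μ νG νN hconj h𝓕 h𝓕₀ h𝓕top hβ hfm measurable_const hfN hfB h1G hL1one
  have hint' : Integrable ((quasiSplit F E c N).quotFun (eisensteinSeriesU fT)) μ := by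
    refine hint.congr (ae_of_all _ fun x => ?_)
    show (quasiSplit F E c N).quotFun (eisensteinSeriesU fT) x * conj (1 : ℂ) = (quasiSplit F E c N).quotFun (eisensteinSeriesU fT) x
    rw [map_one, mul_one]
  have hu2 : MemLp ((quasiSplit F E c N).quotFun (eisensteinSeriesU fT)) 2 μ := MemLp.of_bound hint'.aestronglyMeasurable M (ae_of_all _ fun x => hEle _)
  refine ⟨hu2.toLp _, ?_, fun φ => ?_⟩
  · -- `⟪u, 𝟙⟫ = conj ∫ u ≠ 0` since `Re ∫ u ≥ μ(X) > 0`
    rw [← inner_conj_symm, inner_const_one_left, integral_congr_ae hu2.coeFn_toLp, map_ne_zero]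
    have hre : μ.real Set.univ ≤ (∫ x, (quasiSplit F E c N).quotFun (eisensteinSeriesU fT) x ∂μ).re := by
      have h := integral_re hint'
      simp only [RCLike.re_to_complex] at h
      rw [← h]
      calc μ.real Set.univ = ∫ _ : (quasiSplit F E c N).automorphicQuotient, (1 : ℝ) ∂μ := by rw [integral_const, smul_eq_mul, mul_one]
        _ ≤ ∫ x, ((quasiSplit F E c N).quotFun (eisensteinSeriesU fT) x).re ∂μ := integral_mono (integrable_const _) hint'.re fun x => hEge _
    intro h0
    rw [h0, Complex.zero_re] at hre
    exact measureReal_univ_ne_zero (quasiSplit F E c N) μ (le_antisymm hre measureReal_nonneg)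
  · -- `⟪u, φ⟫ = conj ∫ E(f_T)·conj φ = 0` (★ FILE A, ★ (β1))
    obtain ⟨hΛm, hΛinv, hΛq, hΛB⟩ := invQuot_package_of_mem_cuspForms 𝔓 i h𝔓 νN h𝓕 φ.2
    have hΛG : ∀ (γ : (quasiSplit F E c N).arithmeticSubgroup) (x : (quasiSplit F E c N).Adelic),
        invQuot (quasiSplit F E c N) (φ : (quasiSplit F E c N).automorphicQuotient → ℂ) ((γ : (quasiSplit F E c N).Adelic) * x) =
          invQuot (quasiSplit F E c N) (φ : (quasiSplit F E c N).automorphicQuotient → ℂ) x :=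
      fun γ x => hΛinv _ ((quasiSplit F E c N).arithmeticSubgroup_le_quotientSubgroup γ.2) x
    have hφ1 : Integrable (φ : (quasiSplit F E c N).automorphicQuotient → ℂ) μ := (AdelicGroupData.memLp_of_mem_cuspForms φ.2).integrable one_le_two
    have hq : ∀ x : (quasiSplit F E c N).automorphicQuotient, invQuot (quasiSplit F E c N) (φ : (quasiSplit F E c N).automorphicQuotient → ℂ) (Quotient.out x : (quasiSplit F E c N).Adelic)⁻¹ = (φ : (quasiSplit F E c N).automorphicQuotient → ℂ) x :=
      fun x => congrFun hΛq x
    have hL1 : ∫⁻ g, β g * ‖fT g * conj (invQuot (quasiSplit F E c N) (φ : (quasiSplit F E c N).automorphicQuotient → ℂ) g)‖ₑ ∂νG < ∞ := by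
      refine lintegral_weight_enorm_mul_lt_top_of_lintegral_quotient_lt_top μ νG hβ hfm hΛm hfB hΛG ?_
      calc ∫⁻ x : (quasiSplit F E c N).automorphicQuotient, (∑' q : Quotient (QuotientGroup.rightRel (arithmeticBorel F E c N)),
            ‖fT (((q.out : (quasiSplit F E c N).arithmeticSubgroup) : (quasiSplit F E c N).Adelic) * (Quotient.out x : (quasiSplit F E c N).Adelic)⁻¹)‖ₑ) *
              ‖invQuot (quasiSplit F E c N) (φ : (quasiSplit F E c N).automorphicQuotient → ℂ) (Quotient.out x : (quasiSplit F E c N).Adelic)⁻¹‖ₑ ∂μ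
          ≤ ∫⁻ x, (M : ℝ≥0∞) * ‖(φ : (quasiSplit F E c N).automorphicQuotient → ℂ) x‖ₑ ∂μ := lintegral_mono fun x => by
            rw [hq x]
            exact mul_le_mul' (hXpt x) le_rfl
        _ < ∞ := by
            rw [lintegral_const_mul' _ _ (by simp)]
            exact ENNReal.mul_lt_top (by simp) hφ1.2
    have h0 := integral_quotFun_eisensteinSeriesU_mul_conj_eq_zero_of_borelConstantTerm_eq_zero μ νG νN hconj h𝓕 h𝓕₀ h𝓕top hβ hfm hΛm hfN hfB hΛG hL1 hΛB
    rw [hΛq] at h0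
    rw [AdelicGroupData.cuspFormsToLp_apply, MeasureTheory.L2.inner_def]
    have hae : (fun x : (quasiSplit F E c N).automorphicQuotient => ⟪(hu2.toLp _ : (quasiSplit F E c N).automorphicQuotient → ℂ) x,
        ((AdelicGroupData.memLp_of_mem_cuspForms φ.2).toLp (φ : (quasiSplit F E c N).automorphicQuotient → ℂ) : (quasiSplit F E c N).automorphicQuotient → ℂ) x⟫_ℂ) =ᵐ[μ]
        fun x => conj ((quasiSplit F E c N).quotFun (eisensteinSeriesU fT) x * conj ((φ : (quasiSplit F E c N).automorphicQuotient → ℂ) x)) := by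
      filter_upwards [hu2.coeFn_toLp, (AdelicGroupData.memLp_of_mem_cuspForms φ.2).coeFn_toLp] with x hx hφx
      rw [hx, hφx, RCLike.inner_apply', map_mul, starRingEnd_self_apply]
    rw [integral_congr_ae hae, integral_conj, h0, map_zero]

end Witness

/-! ## §3 HEAD, every rank: cusp forms of `U(J_N)_{E∕F}` have mean zero -/

section Head

variable {F E : Type} [Field F] [NumberField F] [Field E] [NumberField E] [Algebra F E] {c : E ≃ₐ[F] E} {N : ℕ} [NeZero N]
  [MeasurableSpace (quasiSplit F E c N).Adelic] [BorelSpace (quasiSplit F E c N).Adelic]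

/-- **CUSP FORMS HAVE MEAN ZERO, EVERY RANK, `L²` FORM**: under the data of `exists_witness`, `∫_X f dμ = 0` for every `f ∈ L²_cusp(U(J_N)(F)∖U(J_N)(𝔸_F))` (§1 ∘ §2; ergodicity ★ for
`G(𝔸)` locally compact second countable, which `U(J_N)(𝔸_F)` is). [cite: MoeglinWaldspurger1995, I.2.18] [cite: BorelJacquet1979, §4.6] [cite: Zimmer1984, §2.2] -/
theorem integral_eq_zero_of_mem_cuspidalSubspace (μ : Measure (quasiSplit F E c N).automorphicQuotient) [(quasiSplit F E c N).IsAutomorphicMeasure μ]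
    (νG : Measure (quasiSplit F E c N).Adelic) [νG.IsHaarMeasure] [νG.IsInvInvariant]
    (νN : Measure ↥(adelicUnipotent F E c N)) [νN.IsHaarMeasure] [νN.IsInvInvariant]
    (hconj : ∀ b₀ (hb₀ : b₀ ∈ borelU (c : E →+* E) ((StdForm.antidiagonal N).over E)),
      νN.map (fun v : ↥(adelicUnipotent F E c N) => (⟨((quasiSplit F E c N).toAdelic b₀)⁻¹ * (v : (quasiSplit F E c N).Adelic) * (quasiSplit F E c N).toAdelic b₀,
        conj_mem_adelicUnipotent ((K2E1PseudoEisensteinConstantTermU.toAdelic_mem_borelAdelic_iff b₀).2 hb₀) v.2⟩ : ↥(adelicUnipotent F E c N))) = νN)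
    {𝓕 : Set ↥(adelicUnipotent F E c N)} (h𝓕 : IsFundamentalDomain ↥(rationalUnipotent F E c N) 𝓕 νN) (h𝓕₀ : νN 𝓕 ≠ 0) (h𝓕top : νN 𝓕 ≠ ∞)
    (𝔓 : (quasiSplit F E c N).ParabolicUnipotentData) (i : 𝔓.ι) (h𝔓 : 𝔓.radical i = adelicUnipotent F E c N) {T : ℝ≥0}
    (hfin : ∀ y : (quasiSplit F E c N).Adelic, {q : Quotient (QuotientGroup.rightRel (arithmeticBorel F E c N)) |
      T < borelHeight (((q.out : (quasiSplit F E c N).arithmeticSubgroup) : (quasiSplit F E c N).Adelic) * y)}.Finite) {M : ℕ}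
    (hM : ∀ y : (quasiSplit F E c N).Adelic, {q : Quotient (QuotientGroup.rightRel (arithmeticBorel F E c N)) |
      T < borelHeight (((q.out : (quasiSplit F E c N).arithmeticSubgroup) : (quasiSplit F E c N).Adelic) * y)}.ncard ≤ M)
    (hcov : ∀ y : (quasiSplit F E c N).Adelic, ∃ γ : (quasiSplit F E c N).arithmeticSubgroup, T < borelHeight ((γ : (quasiSplit F E c N).Adelic) * y))
    {f : (quasiSplit F E c N).L2 μ} (hf : f ∈ (quasiSplit F E c N).cuspidalSubspace μ 𝔓) :
    ∫ x, (f : (quasiSplit F E c N).automorphicQuotient → ℂ) x ∂μ = 0 := by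
  haveI := t2Space_adeleRing_of_numberField E
  haveI := locallyCompactSpace_adeleRing' E
  haveI := secondCountableTopology_adeleRing E
  haveI : LocallyCompactSpace (quasiSplit F E c N).Adelic := inferInstanceAs (LocallyCompactSpace (adelic F E c N ((StdForm.antidiagonal N).over E)))
  haveI : SecondCountableTopology (quasiSplit F E c N).Adelic := inferInstanceAs (SecondCountableTopology (adelic F E c N ((StdForm.antidiagonal N).over E)))
  obtain ⟨u, hu, horth⟩ := exists_witness μ νG νN hconj h𝓕 h𝓕₀ h𝓕top 𝔓 i h𝔓 hfin hM hcov
  exact integral_eq_zero_of_mem_cuspidalSubspace_of_witness _ μ 𝔓 hu horth hf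

/-- **HEAD — CUSP FORMS OF `U(J_N)_{E∕F}` HAVE MEAN ZERO, EVERY RANK**: under the data of `exists_witness` (at the CM pair all of it is ★, §4), **`∫_X φ dμ = 0` for every continuous
square-integrable cusp form `φ ∈ cuspForms μ 𝔓`** (`𝔓.radical i = N(𝔸)`) — the letter `hmean` of ★ `span_const_le_residualSubspace` («the constant line is residual»), with NO decay
letter, NO Eisenstein continuation and NO residue: ergodicity of `G(𝔸)` on `X` and the unfolding of the Eisenstein series of the height cut-off.
[cite: MoeglinWaldspurger1995, I.2.18] [cite: BorelJacquet1979, §4.4–§4.6] [cite: Zimmer1984, §2.2] -/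
theorem integral_eq_zero_of_mem_cuspForms (μ : Measure (quasiSplit F E c N).automorphicQuotient) [(quasiSplit F E c N).IsAutomorphicMeasure μ]
    (νG : Measure (quasiSplit F E c N).Adelic) [νG.IsHaarMeasure] [νG.IsInvInvariant]
    (νN : Measure ↥(adelicUnipotent F E c N)) [νN.IsHaarMeasure] [νN.IsInvInvariant]
    (hconj : ∀ b₀ (hb₀ : b₀ ∈ borelU (c : E →+* E) ((StdForm.antidiagonal N).over E)),
      νN.map (fun v : ↥(adelicUnipotent F E c N) => (⟨((quasiSplit F E c N).toAdelic b₀)⁻¹ * (v : (quasiSplit F E c N).Adelic) * (quasiSplit F E c N).toAdelic b₀,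
        conj_mem_adelicUnipotent ((K2E1PseudoEisensteinConstantTermU.toAdelic_mem_borelAdelic_iff b₀).2 hb₀) v.2⟩ : ↥(adelicUnipotent F E c N))) = νN)
    {𝓕 : Set ↥(adelicUnipotent F E c N)} (h𝓕 : IsFundamentalDomain ↥(rationalUnipotent F E c N) 𝓕 νN) (h𝓕₀ : νN 𝓕 ≠ 0) (h𝓕top : νN 𝓕 ≠ ∞)
    (𝔓 : (quasiSplit F E c N).ParabolicUnipotentData) (i : 𝔓.ι) (h𝔓 : 𝔓.radical i = adelicUnipotent F E c N) {T : ℝ≥0}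
    (hfin : ∀ y : (quasiSplit F E c N).Adelic, {q : Quotient (QuotientGroup.rightRel (arithmeticBorel F E c N)) |
      T < borelHeight (((q.out : (quasiSplit F E c N).arithmeticSubgroup) : (quasiSplit F E c N).Adelic) * y)}.Finite) {M : ℕ}
    (hM : ∀ y : (quasiSplit F E c N).Adelic, {q : Quotient (QuotientGroup.rightRel (arithmeticBorel F E c N)) |
      T < borelHeight (((q.out : (quasiSplit F E c N).arithmeticSubgroup) : (quasiSplit F E c N).Adelic) * y)}.ncard ≤ M)
    (hcov : ∀ y : (quasiSplit F E c N).Adelic, ∃ γ : (quasiSplit F E c N).arithmeticSubgroup, T < borelHeight ((γ : (quasiSplit F E c N).Adelic) * y)) :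
    ∀ φ ∈ (quasiSplit F E c N).cuspForms μ 𝔓, ∫ x, φ x ∂μ = 0 := by
  haveI := t2Space_adeleRing_of_numberField E
  haveI := locallyCompactSpace_adeleRing' E
  haveI := secondCountableTopology_adeleRing E
  haveI : LocallyCompactSpace (quasiSplit F E c N).Adelic := inferInstanceAs (LocallyCompactSpace (adelic F E c N ((StdForm.antidiagonal N).over E)))
  haveI : SecondCountableTopology (quasiSplit F E c N).Adelic := inferInstanceAs (SecondCountableTopology (adelic F E c N ((StdForm.antidiagonal N).over E)))
  obtain ⟨u, hu, horth⟩ := exists_witness μ νG νN hconj h𝓕 h𝓕₀ h𝓕top 𝔓 i h𝔓 hfin hM hcov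
  exact fun φ hφ => integral_eq_zero_of_mem_cuspForms_of_witness _ μ 𝔓 hu horth hφ

end Head

end Summit.HodgeConjecture.HodgeConjecture.Cruxes.H413.K2E1CuspFormsMeanZeroSoftU

end
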